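import Literature.MathematicalPhysics.QuantumLattice.SpinSectorPartitionFnParticleHole
import Literature.MathematicalPhysics.QuantumLattice.HubbardTTPrimeThermalPressureLimit
import HarnessLib

/-!
# The sign of the nearest-neighbour hopping is immaterial for the thermal pressure of the 2D `t–t'` Hubbard model

Topic `MathematicalPhysics/QuantumLattice` (family `hubbard`); the `T > 0` twin of `energyDensityTT'_neg_t`
(`HubbardTTPrimeDiagonalUAnchors`). Downfolded one-band parameters arrive with either sign convention for `t`;
at every temperature the canonical partition functions of the even tori — hence the thermal pressure of record
`p(β; t,t',U; n) = pressureTT' β t t' U n` — depend on `t` only through `|t|` (the sign of `t'` DOES matter away from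
half filling: `pressureTT'_particleHole`).

* `particleHole_uniform_hubbardRectTorusTT'` — the uniform-sign particle–hole conjugation of the torus Hamiltonian
  (ANY sides): `P₀ H_{a×b}(t,t',U) P₀ᴴ = H_{a×b}(−t,−t',U) − U N + U ab`;
* `partitionFn_spinSector_hubbardRectTorusTT'_particleHole_uniform` — `Z_β(H_{a×b}(t,t',U); p,q) =
  e^{βU(ab−p−q)} Z_β(H_{a×b}(−t,−t',U); ab−p, ab−q)`;
* `partitionFn_spinSector_hubbardRectTorusTT'_neg_t` — for `a, b` EVEN: `Z_β(H_{a×b}(−t,t',U); p,q) =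
  Z_β(H_{a×b}(t,t',U); p,q)` (staggered conjugation of the tree followed by the uniform one = the gauge
  `c_{xσ} ↦ (−1)^{x₁+x₂} c_{xσ}`);
* `sectorPressureTT'_neg_t` (even `L`), `pressureTT'_neg_t`, `pressureTT'_abs_t` (`β ≥ 0`, `U ≥ 0`, `0 ≤ n < 2`).

Everything is PROVED; no definition, no named fact.

## Mathlib / tree search

REUSED: `hamiltonian_particleHole_sameSign`, `partitionFn_spinSectorHamiltonian_particleHole_transfer`,
`partitionFn_spinSector_hubbardRectTorusTT'_particleHole` (`SpinSectorPartitionFnParticleHole`, `HubbardNNNHoppingRectSymmetries`),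
`log_partitionFn_sectorHamiltonianTT'_eq_rect`, `tendsto_sectorPressureTT'`, `halfRectN_lt_sq`
(`HubbardTTPrimeThermalPressureLimit`). `lean search 'pressureTT.*neg_t|RectTorusTT.*particleHole_uniform'`: only the
`T = 0` / open-box forms (2026-08-27).

## References

* F. H. L. Essler, H. Frahm, F. Göhmann, A. Klümper, V. E. Korepin, *The One-Dimensional Hubbard Model* (2005),
  §2.2.4 eqs. (2.59)–(2.61). [cite: EsslerEtAl2005, §2.2.4 eqs. (2.59)–(2.61)]
* E. H. Lieb, *The Hubbard model: some rigorous results and open problems*, arXiv:cond-mat/9311033, §2.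
  [cite: arXiv9311033, §2]
-/

noncomputable section

namespace Literature.MathematicalPhysics.QuantumLattice

open Matrix Finset HubbardWave0 ThermodynamicLimit LiebThm1
open _root_.Filter
open scoped _root_.Topology ComplexOrder BigOperators

section RectTorus

variable {a b : ℕ}

/-- **Uniform-sign particle–hole conjugation of the `t–t'` torus Hamiltonian** (phases all `+1`, ANY sides):
`P₀ H_{a×b}(t, t', U) P₀ᴴ = H_{a×b}(−t, −t', U) − U N + U ab` (every bond is a same-sign bond).
[cite: EsslerEtAl2005, §2.2.4 eqs. (2.59)–(2.61)] -/
theorem particleHole_uniform_hubbardRectTorusTT' (a b : ℕ) (t t' U : ℝ) :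
    particleHole (fun i : Orb (Fin a ×ₗ Fin b) => (((fun _ : Fin a ×ₗ Fin b => (1 : ℤˣ)) (ofLex i).1 : ℤ) : ℂ)) *
        hubbardRectTorusTT' a b t t' U *
        (particleHole (fun i : Orb (Fin a ×ₗ Fin b) =>
          (((fun _ : Fin a ×ₗ Fin b => (1 : ℤˣ)) (ofLex i).1 : ℤ) : ℂ)))ᴴ =
      hubbardRectTorusTT' a b (-t) (-t') U - (U : ℂ) • totalNumber +
        ((U * (a * b) : ℝ) : ℂ) •
          (1 : Matrix (Finset (Orb (Fin a ×ₗ Fin b))) (Finset (Orb (Fin a ×ₗ Fin b))) ℂ) := by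
  have hNN := hamiltonian_particleHole_sameSign (fermionRectTorusGraph a b) t U
    (fun _ => (1 : ℤˣ)) (fun _ _ _ => rfl)
  have hNNN := hamiltonian_particleHole_sameSign (fermionRectTorusDiagGraph a b) t' 0
    (fun _ => (1 : ℤˣ)) (fun _ _ _ => rfl)
  have hcard : Fintype.card (Fin a ×ₗ Fin b) = a * b := card_rectSites a b
  have key := congrArg₂ (· + ·) hNN hNNN
  simp only [zero_mul, Complex.ofReal_zero, zero_smul, sub_zero, add_zero] at key
  rw [← Matrix.add_mul, ← Matrix.mul_add, ← hubbardRectTorusTT', add_right_comm,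
    sub_add_eq_add_sub, ← hubbardRectTorusTT', hcard] at key
  push_cast at key ⊢
  convert key

/-- **Uniform-sign transfer on the torus**: `Z_β(H_{a×b}(t, t', U); p, q) = e^{βU(ab − p − q)} ·
Z_β(H_{a×b}(−t, −t', U); p', q')` for `p + p' = q + q' = ab` (ANY sides, every `β`).
[cite: EsslerEtAl2005, §2.2.4 eqs. (2.59)–(2.61)] -/
theorem partitionFn_spinSector_hubbardRectTorusTT'_particleHole_uniform (a b : ℕ) (β t t' U : ℝ)
    {p q p' q' : ℕ} (hp : p + p' = a * b) (hq : q + q' = a * b) :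
    partitionFn β (spinSectorHamiltonian p q (hubbardRectTorusTT' a b t t' U)) =
      (Real.exp (β * U * ((a : ℝ) * b - p - q)) : ℂ) *
        partitionFn β (spinSectorHamiltonian p' q' (hubbardRectTorusTT' a b (-t) (-t') U)) := by
  have hcard : Fintype.card (Fin a ×ₗ Fin b) = a * b := card_rectSites a b
  have hn : ∀ i : Orb (Fin a ×ₗ Fin b),
      ‖(((fun _ : Fin a ×ₗ Fin b => (1 : ℤˣ)) (ofLex i).1 : ℤ) : ℂ)‖ = 1 :=
    fun i => norm_intCast_units _
  rw [partitionFn_spinSectorHamiltonian_particleHole_transfer _ hn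
    (particleHole_uniform_hubbardRectTorusTT' a b t t' U) (by rw [hcard]; exact hp) (by rw [hcard]; exact hq) β]
  congr 2
  have hp' : (p' : ℝ) = a * b - p := by
    have := congrArg (fun n : ℕ => (n : ℝ)) hp; push_cast at this; linarith
  have hq' : (q' : ℝ) = a * b - q := by
    have := congrArg (fun n : ℕ => (n : ℝ)) hq; push_cast at this; linarith
  rw [hp', hq']
  ring

/-- **The sign of `t` is immaterial for every canonical partition function of an even torus**: for `a, b` even,
every sector `p, q ≤ ab` and every `β`, `Z_β(H_{a×b}(−t, t', U); p, q) = Z_β(H_{a×b}(t, t', U); p, q)` — the staggered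
conjugation (`partitionFn_spinSector_hubbardRectTorusTT'_particleHole`) followed by the uniform one is the gauge
`c_{xσ} ↦ (−1)^{x₁+x₂} c_{xσ}`, which flips the nearest-neighbour bonds and fixes the diagonal ones and every sector.
[cite: arXiv9311033, §2] -/
theorem partitionFn_spinSector_hubbardRectTorusTT'_neg_t (ha : Even a) (hb : Even b) (β t t' U : ℝ) {p q : ℕ}
    (hp : p ≤ a * b) (hq : q ≤ a * b) :
    partitionFn β (spinSectorHamiltonian p q (hubbardRectTorusTT' a b (-t) t' U)) =
      partitionFn β (spinSectorHamiltonian p q (hubbardRectTorusTT' a b t t' U)) := by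
  have hp' : p + (a * b - p) = a * b := by omega
  have hq' : q + (a * b - q) = a * b := by omega
  rw [partitionFn_spinSector_hubbardRectTorusTT'_particleHole ha hb β (-t) t' U hp' hq',
    partitionFn_spinSector_hubbardRectTorusTT'_particleHole_uniform a b β t t' U hp' hq']

end RectTorus

namespace ThermodynamicLimit

/-- **Even tori: `p_L(β; −t,t',U; n) = p_L(β; t,t',U; n)`** (`0 ≤ n < 2`, `L ≥ 1` even). [cite: arXiv9311033, §2] -/
theorem sectorPressureTT'_neg_t (β t t' U : ℝ) {n : ℝ} (hn0 : 0 ≤ n) (hn2 : n < 2) {L : ℕ} (hL : Even L)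
    (hL1 : 1 ≤ L) : sectorPressureTT' β (-t) t' U n L = sectorPressureTT' β t t' U n L := by
  unfold sectorPressureTT'
  rw [log_partitionFn_sectorHamiltonianTT'_eq_rect, log_partitionFn_sectorHamiltonianTT'_eq_rect,
    partitionFn_spinSector_hubbardRectTorusTT'_neg_t hL hL β t t' U (halfRectN_lt_sq hn0 hn2 hL1).le
      (halfRectN_lt_sq hn0 hn2 hL1).le]

variable {β : ℝ} (hβ : 0 ≤ β) (t t' : ℝ) {U : ℝ} (hU : 0 ≤ U) {n : ℝ} (hn0 : 0 ≤ n) (hn2 : n < 2)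
include hβ hU hn0 hn2

/-- **`p(β; −t, t', U; n) = p(β; t, t', U; n)`**: the thermal pressure of the 2D `t–t'` Hubbard model does not
depend on the sign of the nearest-neighbour hopping (the defining sequences agree along the even tori). The sign
of `t'` DOES matter away from half filling (`pressureTT'_particleHole`). [cite: arXiv9311033, §2] -/
theorem pressureTT'_neg_t : pressureTT' β (-t) t' U n = pressureTT' β t t' U n := by
  have h1 := tendsto_sectorPressureTT' hβ (-t) t' hU hn0 hn2
  have h2 := tendsto_sectorPressureTT' hβ t t' hU hn0 hn2
  have hT : Tendsto (fun M : ℕ => 2 * (M + 1)) atTop atTop :=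
    (Filter.tendsto_id.const_mul_atTop' (by norm_num : 0 < 2)).comp (tendsto_add_atTop_nat 1)
  refine tendsto_nhds_unique (h1.comp hT) ((h2.comp hT).congr fun M => ?_)
  simp only [Function.comp_apply]
  rw [sectorPressureTT'_neg_t β t t' U hn0 hn2 (even_two_mul (M + 1)) (by omega)]

/-- `p(β; |t|, t', U; n) = p(β; t, t', U; n)`. [cite: arXiv9311033, §2] -/
theorem pressureTT'_abs_t : pressureTT' β |t| t' U n = pressureTT' β t t' U n := by
  rcases le_total 0 t with ht | ht
  · rw [abs_of_nonneg ht]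
  · rw [abs_of_nonpos ht, pressureTT'_neg_t hβ t t' hU hn0 hn2]

end ThermodynamicLimit

end Literature.MathematicalPhysics.QuantumLattice
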